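import Summits.QuantumFields.BalabanUV.T4Continuum.Support.BlockMultiplication

/-!
# T⁴ programme, spine node NE2 (U1a) — MATRIX-UNIT DECOMPOSITION of colour operators: `siteMul w = Σ_{a,b} diag(w_{ab}) ⊗ E_{ab}`
# and the transport of `PerturbationLaws` along `X ↦ X ⊗ E_{ab}` (tier B, rows B1/B2 of `t4/SKELETON-NE2-P1.md`)

Ninth generation of the NE2 prover lineage P1 of the cell `pub-balaban`, file 18 (on top of file 17).  THE REDUCTION OF TIER B TO
TIER A: a colour-mixing perturbation built from site-wise colour matrices is a finite sum `Σ_{a,b} P_{ab} ⊗ E_{ab}` of SCALAR (tier-A)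
perturbations tensored with matrix units; the typed inequalities `PerturbationLaws` are subadditive (`perturbationLaws_add`, here
**`perturbationLaws_finsetSum`**) and are transported along `X ↦ X ⊗ E_{ab}` against the lifted free tower (**`perturbationLaws_kronUnit`**,
from `‖X ⊗ B‖ ≤ ‖X‖·‖B‖` (**`opNorm_kron_mul_le`**) and `‖E_{ab}‖ ≤ 1`).  Hence every tier-A law (`FirstOrderBackgroundModel`,
`FirstOrderAdjointModel`, `PerturbationAlgebra` zeroth order) yields its non-abelian twin with constants × `(card o)²` and NO analysis
redone.  §3 gives the decompositions **`siteMul_eq_sum_kron_single`** and **`siteMul_mul_kron_eq_sum`**.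

HONEST FRAMING (T4-DAG p. 1).  Pure finite-dimensional linear algebra; no estimate of the programme is touched; constants OURS (the
factor `(card o)²` is crude and explicit); NOT infinite volume / mass gap / Clay / summit progress; spine 0/9 unchanged.  HONEST
DEPENDENCY: continuum YM on T⁴ ⇐ BetaPertH ∧ nine spine estimates (0/9 proved); BetaPertH ⇐ (D1) ∧ (D4) ∧ CAP+tail; G-an2-4 gates asym,
D1 and NE2/3/4.  ABSOLUTE RULE kept; no `sorry`.
-/

noncomputable section

open scoped BigOperators ComplexConjugate Matrix Matrix.Norms.L2Operator Kronecker

namespace Summit.QuantumFields.BalabanUV.T4Continuum.KroneckerUnits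

open Literature.MathematicalPhysics.QuantumFieldTheory.Balaban1983to89.B5G183RateOp (opNorm_le_of_schur)
open Summit.QuantumFields.BalabanUV.T4Continuum.BackgroundResolventTower
open Summit.QuantumFields.BalabanUV.T4Continuum.KroneckerLift
open Summit.QuantumFields.BalabanUV.T4Continuum.BlockMultiplication

/-! ## §1 Norms of Kronecker products and of matrix units -/

section Norms

variable {ι ι' o : Type*}

/-- `1 ⊗ B` is the constant site-wise multiplication. [folklore] -/
theorem one_kron_eq_siteMul [DecidableEq ι] (B : Matrix o o ℂ) : (1 : Matrix ι ι ℂ) ⊗ₖ B = siteMul fun _ : ι => B := by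
  ext a b
  rw [siteMul_apply]
  rcases a with ⟨i, k⟩; rcases b with ⟨j, l⟩
  simp only [Matrix.kronecker_apply, Matrix.one_apply]
  split_ifs <;> simp

/-- `‖1 ⊗ B‖ ≤ ‖B‖`. [folklore] -/
theorem opNorm_one_kron_le [Fintype ι] [Fintype o] [DecidableEq ι] [DecidableEq o] (B : Matrix o o ℂ) :
    ‖(1 : Matrix ι ι ℂ) ⊗ₖ B‖ ≤ ‖B‖ := by
  rw [one_kron_eq_siteMul]; exact opNorm_siteMul_le _ (norm_nonneg B) fun _ => le_rfl

/-- **`‖A ⊗ B‖ ≤ ‖A‖·‖B‖`** (A rectangular, B square). [folklore] -/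
theorem opNorm_kron_mul_le [Fintype ι] [Fintype ι'] [Fintype o] [DecidableEq ι] [DecidableEq ι'] [DecidableEq o]
    (A : Matrix ι ι' ℂ) (B : Matrix o o ℂ) : ‖A ⊗ₖ B‖ ≤ ‖A‖ * ‖B‖ := by
  have e : A ⊗ₖ B = A ⊗ₖ (1 : Matrix o o ℂ) * (1 : Matrix ι' ι' ℂ) ⊗ₖ B := by
    rw [← Matrix.mul_kronecker_mul, Matrix.mul_one, Matrix.one_mul]
  rw [e]
  exact (Matrix.l2_opNorm_mul _ _).trans (mul_le_mul (opNorm_kron_le o A) (opNorm_one_kron_le B) (norm_nonneg _) (norm_nonneg _))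

/-- entries of a matrix unit. [folklore] -/
theorem single_apply' [DecidableEq o] (a b : o) (c : ℂ) (i j : o) : Matrix.single a b c i j = if a = i ∧ b = j then c else 0 := rfl

/-- `‖E_{ab}‖ ≤ 1`. [folklore] -/
theorem opNorm_single_le [Fintype o] [DecidableEq o] (a b : o) : ‖Matrix.single a b (1 : ℂ)‖ ≤ 1 := by
  refine opNorm_le_of_schur _ zero_le_one (fun i => ?_) (fun j => ?_)
  · by_cases hi : a = i
    · rw [Finset.sum_eq_single b]
      · simp [hi]
      · intro j _ hj; simp [Ne.symm hj]
      · intro h; exact absurd (Finset.mem_univ _) h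
    · have h0 : ∀ j, ‖Matrix.single a b (1 : ℂ) i j‖ = 0 := fun j => by simp [hi]
      simp [h0]
  · by_cases hj : b = j
    · rw [Finset.sum_eq_single a]
      · simp [hj]
      · intro i _ hi; simp [Ne.symm hi]
      · intro h; exact absurd (Finset.mem_univ _) h
    · have h0 : ∀ i, ‖Matrix.single a b (1 : ℂ) i j‖ = 0 := fun i => by simp [hj]
      simp [h0]

/-- `E_{ab}ᴴ = E_{ba}`. [folklore] -/
theorem conjTranspose_single_one [DecidableEq o] (a b : o) : (Matrix.single a b (1 : ℂ))ᴴ = Matrix.single b a 1 := by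
  ext i j
  simp only [Matrix.conjTranspose_apply, single_apply']
  by_cases h : b = i ∧ a = j
  · rw [if_pos h, if_pos ⟨h.2, h.1⟩, star_one]
  · rw [if_neg h, if_neg (fun h' => h ⟨h'.2, h'.1⟩), star_zero]

/-- `‖X ⊗ E_{ab}‖ ≤ ‖X‖`. [folklore] -/
theorem opNorm_kron_single_le [Fintype ι] [Fintype ι'] [Fintype o] [DecidableEq ι] [DecidableEq ι'] [DecidableEq o]
    (X : Matrix ι ι' ℂ) (a b : o) : ‖X ⊗ₖ Matrix.single a b (1 : ℂ)‖ ≤ ‖X‖ :=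
  (opNorm_kron_mul_le X _).trans (mul_le_of_le_one_right (norm_nonneg _) (opNorm_single_le a b))

end Norms

/-! ## §2 Transport of `PerturbationLaws` along `X ↦ X ⊗ E_{ab}` and finite sums -/

section Transport

variable {ι : ℕ → Type*} [∀ k, Fintype (ι k)] [∀ k, DecidableEq (ι k)] {o : Type*} [Fintype o] [DecidableEq o]

/-- **`PerturbationLaws` TRANSPORTED ALONG `X ↦ X ⊗ E_{ab}`** against the lifted free tower (same constants). [folklore] -/
theorem perturbationLaws_kronUnit {D P : (k : ℕ) → Matrix (ι k) (ι k) ℂ} {J : (k : ℕ) → Matrix (ι (k + 1)) (ι k) ℂ} {κ : ℝ}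
    {e₂ : ℕ → ℝ} (h : PerturbationLaws D P J κ e₂) (a b : o) :
    PerturbationLaws (fun k => D k ⊗ₖ (1 : Matrix o o ℂ)) (fun k => P k ⊗ₖ Matrix.single a b (1 : ℂ))
      (fun k => J k ⊗ₖ (1 : Matrix o o ℂ)) κ e₂ where
  opNorm_P_mul_inv_le := fun k => by
    rw [kron_inv, ← Matrix.mul_kronecker_mul, Matrix.mul_one]
    exact (opNorm_kron_single_le _ a b).trans (h.opNorm_P_mul_inv_le k)
  opNorm_inv_mul_P_le := fun k => by
    rw [kron_inv, ← Matrix.mul_kronecker_mul, Matrix.one_mul]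
    exact (opNorm_kron_single_le _ a b).trans (h.opNorm_inv_mul_P_le k)
  consistent_le := fun k => by
    rw [kron_inv, kron_inv, ← Matrix.mul_kronecker_mul, Matrix.mul_one, ← Matrix.mul_kronecker_mul, Matrix.one_mul, ← sub_kronecker,
      ← Matrix.mul_kronecker_mul, Matrix.one_mul, ← Matrix.mul_kronecker_mul, Matrix.mul_one]
    exact (opNorm_kron_single_le _ a b).trans (h.consistent_le k)

omit [Fintype o] [DecidableEq o] in
/-- **`PerturbationLaws` FOR FINITE SUMS** (any free tower; (H-bd) and (H-cons) are subadditive). [folklore] -/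
theorem perturbationLaws_finsetSum {σ : Type*} (s : Finset σ) {D : (k : ℕ) → Matrix (ι k) (ι k) ℂ}
    {J : (k : ℕ) → Matrix (ι (k + 1)) (ι k) ℂ} {P : σ → (k : ℕ) → Matrix (ι k) (ι k) ℂ} {κ : σ → ℝ} {e : σ → ℕ → ℝ}
    (h : ∀ x ∈ s, PerturbationLaws D (P x) J (κ x) (e x)) :
    PerturbationLaws D (fun k => ∑ x ∈ s, P x k) J (∑ x ∈ s, κ x) (fun k => ∑ x ∈ s, e x k) where
  opNorm_P_mul_inv_le := fun k => by
    rw [Matrix.sum_mul]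
    exact (norm_sum_le _ _).trans (Finset.sum_le_sum fun x hx => (h x hx).opNorm_P_mul_inv_le k)
  opNorm_inv_mul_P_le := fun k => by
    rw [Matrix.mul_sum]
    exact (norm_sum_le _ _).trans (Finset.sum_le_sum fun x hx => (h x hx).opNorm_inv_mul_P_le k)
  consistent_le := fun k => by
    rw [Matrix.sum_mul, Matrix.mul_sum, ← Finset.sum_sub_distrib, Matrix.mul_sum, Matrix.sum_mul]
    exact (norm_sum_le _ _).trans (Finset.sum_le_sum fun x hx => (h x hx).consistent_le k)

end Transport

/-! ## §3 The matrix-unit decompositions -/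

section Decomp

variable {ι ι' o : Type*} [Fintype o] [DecidableEq o]

omit [Fintype o] [DecidableEq o] in
/-- finite sums pass through the left Kronecker factor. [folklore] -/
theorem sum_kronecker {σ : Type*} (s : Finset σ) (f : σ → Matrix ι ι' ℂ) (B : Matrix o o ℂ) :
    (∑ x ∈ s, f x) ⊗ₖ B = ∑ x ∈ s, f x ⊗ₖ B := by
  classical
  induction s using Finset.induction_on with
  | empty => simp
  | @insert x s hx ih => rw [Finset.sum_insert hx, Finset.sum_insert hx, Matrix.add_kronecker, ih]

/-- **`siteMul w = Σ_{a,b} diag(i ↦ w i a b) ⊗ E_{ab}`**. [folklore] -/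
theorem siteMul_eq_sum_kron_single [DecidableEq ι] (w : ι → Matrix o o ℂ) :
    siteMul w = ∑ a, ∑ b, Matrix.diagonal (fun i => w i a b) ⊗ₖ Matrix.single a b (1 : ℂ) := by
  ext p q
  rw [siteMul_apply, Matrix.sum_apply, Finset.sum_eq_single p.2]
  · rw [Matrix.sum_apply, Finset.sum_eq_single q.2]
    · rcases p with ⟨i, k⟩; rcases q with ⟨j, l⟩
      simp only [Matrix.kronecker_apply, Matrix.diagonal_apply, single_apply']
      by_cases h : i = j
      · subst h; simp
      · simp [h]
    · intro b _ hb
      rcases p with ⟨i, k⟩; rcases q with ⟨j, l⟩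
      rw [Matrix.kronecker_apply, single_apply', if_neg (fun h => hb h.2), mul_zero]
    · intro h; exact absurd (Finset.mem_univ _) h
  · intro a _ ha
    rw [Matrix.sum_apply]
    refine Finset.sum_eq_zero fun b _ => ?_
    rcases p with ⟨i, k⟩; rcases q with ⟨j, l⟩
    rw [Matrix.kronecker_apply, single_apply', if_neg (fun h => ha h.1), mul_zero]
  · intro h; exact absurd (Finset.mem_univ _) h

/-- `siteMul w · (X ⊗ 1) = Σ_{a,b} (diag(w_{ab})·X) ⊗ E_{ab}`. [folklore] -/
theorem siteMul_mul_kron_eq_sum [Fintype ι] [DecidableEq ι] (w : ι → Matrix o o ℂ) (X : Matrix ι ι' ℂ) :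
    siteMul w * X ⊗ₖ (1 : Matrix o o ℂ) = ∑ a, ∑ b, (Matrix.diagonal (fun i => w i a b) * X) ⊗ₖ Matrix.single a b (1 : ℂ) := by
  rw [siteMul_eq_sum_kron_single, Matrix.sum_mul]
  refine Finset.sum_congr rfl fun a _ => ?_
  rw [Matrix.sum_mul]
  refine Finset.sum_congr rfl fun b _ => ?_
  rw [← Matrix.mul_kronecker_mul, Matrix.mul_one]

/-- `(siteMul w · (X ⊗ 1))ᴴ = Σ_{a,b} (diag(w_{ab})·X)ᴴ ⊗ E_{ba}`. [folklore] -/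
theorem conjTranspose_siteMul_mul_kron_eq_sum [Fintype ι] [DecidableEq ι] [Fintype ι'] [DecidableEq ι'] (w : ι → Matrix o o ℂ)
    (X : Matrix ι ι' ℂ) :
    (siteMul w * X ⊗ₖ (1 : Matrix o o ℂ))ᴴ = ∑ a, ∑ b, (Matrix.diagonal (fun i => w i a b) * X)ᴴ ⊗ₖ Matrix.single b a (1 : ℂ) := by
  rw [siteMul_mul_kron_eq_sum, Matrix.conjTranspose_sum]
  refine Finset.sum_congr rfl fun a _ => ?_
  rw [Matrix.conjTranspose_sum]
  refine Finset.sum_congr rfl fun b _ => ?_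
  rw [Matrix.conjTranspose_kronecker, conjTranspose_single_one]

/-- entries of a colour matrix are bounded by its norm (for deriving scalar hypotheses from matrix ones). [folklore] -/
theorem norm_entry_le (X : Matrix o o ℂ) (a b : o) : ‖X a b‖ ≤ ‖X‖ :=
  BalabanAveragedTowerUnit.norm_entry_le_opNorm X a b

end Decomp

end Summit.QuantumFields.BalabanUV.T4Continuum.KroneckerUnits

end
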